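import Mathlib
import Literature.Computability.AlgebraicComplexity.PermanentIrreducible
import Literature.Computability.AlgebraicComplexity.StandardFamiliesProofs

/-!
# Crux `DivisionGap.PerCofactorDegreeReduction` (stmt-ValiantsHypothesis-15046), line `Sketch` —
# stub `stub_twoSignedRealization`: two-signed classes modulo the permanent absorb every sign of a
# binary form

A class of `ℝ[x_ij]/(per_n)` is *two-signed* if it has a nonnegative representative `V` and a
nonpositive one `-V'` (`V, V' ∈ ℝ≥0[x_ij]`, `V + V' ∈ (per_n)`).

**Theorem (`stub_twoSignedRealization`).** Let `V₁, V₁', V₂, V₂' ∈ ℝ≥0[x_ij]` (`n × n` variables)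
have total degree `≤ d`, with `per_n ∣ V₁ + V₁'` and `per_n ∣ V₂ + V₂'` over `ℝ`.  Then for every
`m ≥ 1` and every real binary form `Σ_{i ≤ m} cᵢ aⁱ b^{m-i}` there is a nonnegative
`u ∈ ℝ≥0[x_ij]` of total degree `≤ m·d` with
`per_n ∣ u - Σ_{i ≤ m} cᵢ V₁ⁱ V₂^{m-i}` over `ℝ`.

## Proof

Term by term, then sum (`Finset.dvd_sum`, `totalDegree_finsetSum_le`).  For an index `i ≤ m`:
* if `cᵢ ≥ 0`, take `tᵢ = cᵢ V₁ⁱ V₂^{m-i}` (difference `0`);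
* if `cᵢ < 0` and `i < m`, take `tᵢ = |cᵢ| V₁ⁱ V₂' V₂^{m-i-1}`; then
  `tᵢ - cᵢ V₁ⁱ V₂^{m-i} = |cᵢ| V₁ⁱ V₂^{m-i-1} (V₂ + V₂')` is a multiple of `per_n`;
* if `c_m < 0` (`i = m ≥ 1`), take `t_m = |c_m| V₁' V₁^{m-1}`; then
  `t_m - c_m V₁^m = |c_m| V₁^{m-1} (V₁ + V₁')` is a multiple of `per_n`.
Each `tᵢ` is nonnegative (coefficients `Real.toNNReal`) of total degree `≤ i·d + (m-i)·d = m·d`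
(`totalDegree_mul`, `totalDegree_pow`, `totalDegree_C`).
-/

noncomputable section

-- `Summit.ValiantsHypothesis.ValiantsHypothesis.…` is the tree's mandated single-conjunct layout
-- (Problem = Summit), so the duplicated namespace component is intended.
set_option linter.dupNamespace false

namespace Summit.ValiantsHypothesis.ValiantsHypothesis.Theorems.DivisionGap.PerCofactorDegreeReduction.TwoSignedRealization

open MvPolynomial Literature.Computability.AlgebraicComplexity
open scoped NNReal BigOperators

/-- Degree bookkeeping: a product `C a * p ^ i * q ^ j` of polynomials of total degree `≤ d` has
total degree `≤ (i + j) * d`. [folklore] -/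
theorem totalDegree_C_mul_pow_mul_pow_le {σ R : Type*} [CommSemiring R] (a : R)
    (p q : MvPolynomial σ R) (i j d : ℕ) (hp : p.totalDegree ≤ d) (hq : q.totalDegree ≤ d) :
    (C a * p ^ i * q ^ j).totalDegree ≤ (i + j) * d := by
  calc (C a * p ^ i * q ^ j).totalDegree
      ≤ (C a * p ^ i).totalDegree + (q ^ j).totalDegree := totalDegree_mul _ _
    _ ≤ ((C a).totalDegree + (p ^ i).totalDegree) + (q ^ j).totalDegree :=
        Nat.add_le_add_right (totalDegree_mul _ _) _
    _ ≤ (0 + i * d) + j * d := by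
        gcongr
        · exact (totalDegree_C a).le
        · exact (totalDegree_pow _ _).trans (Nat.mul_le_mul_left _ hp)
        · exact (totalDegree_pow _ _).trans (Nat.mul_le_mul_left _ hq)
    _ = (i + j) * d := by ring

/-- Degree bookkeeping: a product `C a * p ^ i * r * q ^ j` of polynomials of total degree `≤ d`
has total degree `≤ (i + 1 + j) * d`. [folklore] -/
theorem totalDegree_C_mul_pow_mul_mul_pow_le {σ R : Type*} [CommSemiring R] (a : R)
    (p r q : MvPolynomial σ R) (i j d : ℕ) (hp : p.totalDegree ≤ d) (hr : r.totalDegree ≤ d)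
    (hq : q.totalDegree ≤ d) :
    (C a * p ^ i * r * q ^ j).totalDegree ≤ (i + 1 + j) * d := by
  calc (C a * p ^ i * r * q ^ j).totalDegree
      ≤ (C a * p ^ i * r).totalDegree + (q ^ j).totalDegree := totalDegree_mul _ _
    _ ≤ ((C a * p ^ i).totalDegree + r.totalDegree) + (q ^ j).totalDegree :=
        Nat.add_le_add_right (totalDegree_mul _ _) _
    _ ≤ (((C a).totalDegree + (p ^ i).totalDegree) + r.totalDegree) + (q ^ j).totalDegree :=
        Nat.add_le_add_right (Nat.add_le_add_right (totalDegree_mul _ _) _) _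
    _ ≤ ((0 + i * d) + d) + j * d := by
        gcongr
        · exact (totalDegree_C a).le
        · exact (totalDegree_pow _ _).trans (Nat.mul_le_mul_left _ hp)
        · exact (totalDegree_pow _ _).trans (Nat.mul_le_mul_left _ hq)
    _ = (i + 1 + j) * d := by ring

/-- **stub_twoSignedRealization — TWO-SIGNED CLASSES ABSORB EVERY SIGN.**  If `V₁ + V₁' ∈ (per_n)`
and `V₂ + V₂' ∈ (per_n)` over `ℝ` (all four nonnegative of degree `≤ d`; the classes
`A = [V₁] = −[V₁']`, `B = [V₂] = −[V₂']` are TWO-SIGNED), then for every real binary form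
`Σ_{i ≤ m} cᵢ aⁱ b^{m−i}` of degree `m ≥ 1` the class `Σ cᵢ Aⁱ B^{m−i}` has a NONNEGATIVE
representative `u` of degree `≤ m·d`: take `cᵢ V₁ⁱ V₂^{m−i}` if `cᵢ ≥ 0`,
`|cᵢ| V₁ⁱ V₂' V₂^{m−i−1}` if `cᵢ < 0` and `i < m`, and `|c_m| V₁' V₁^{m−1}` if `c_m < 0` (one
factor replaced by its antipode flips the sign modulo `per_n`). [folklore] -/
theorem stub_twoSignedRealization (n m d : ℕ) (hm : 1 ≤ m)
    (V₁ V₁' V₂ V₂' : MvPolynomial (Fin n × Fin n) ℝ≥0)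
    (h₁ : perPoly (Fin n) ℝ ∣ MvPolynomial.map NNReal.toRealHom (V₁ + V₁'))
    (h₂ : perPoly (Fin n) ℝ ∣ MvPolynomial.map NNReal.toRealHom (V₂ + V₂'))
    (hd₁ : V₁.totalDegree ≤ d) (hd₁' : V₁'.totalDegree ≤ d)
    (hd₂ : V₂.totalDegree ≤ d) (hd₂' : V₂'.totalDegree ≤ d)
    (c : Fin (m + 1) → ℝ) :
    ∃ u : MvPolynomial (Fin n × Fin n) ℝ≥0, u.totalDegree ≤ m * d ∧
      perPoly (Fin n) ℝ ∣ MvPolynomial.map NNReal.toRealHom u -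
        ∑ i : Fin (m + 1), C (c i) * MvPolynomial.map NNReal.toRealHom V₁ ^ (i : ℕ) *
          MvPolynomial.map NNReal.toRealHom V₂ ^ (m - (i : ℕ)) := by
  rw [map_add] at h₁ h₂
  -- term-by-term realization
  have key : ∀ i : Fin (m + 1), ∃ t : MvPolynomial (Fin n × Fin n) ℝ≥0,
      t.totalDegree ≤ m * d ∧
        perPoly (Fin n) ℝ ∣ MvPolynomial.map NNReal.toRealHom t -
          C (c i) * MvPolynomial.map NNReal.toRealHom V₁ ^ (i : ℕ) *
            MvPolynomial.map NNReal.toRealHom V₂ ^ (m - (i : ℕ)) := by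
    intro i
    have hi : (i : ℕ) ≤ m := Nat.lt_succ_iff.mp i.isLt
    rcases le_or_gt 0 (c i) with hc | hc
    · -- `cᵢ ≥ 0`: the term itself is nonnegative
      refine ⟨C (c i).toNNReal * V₁ ^ (i : ℕ) * V₂ ^ (m - (i : ℕ)), ?_, ?_⟩
      · refine (totalDegree_C_mul_pow_mul_pow_le _ _ _ _ _ _ hd₁ hd₂).trans (le_of_eq ?_)
        rw [Nat.add_sub_cancel' hi]
      · rw [map_mul, map_mul, map_pow, map_pow, map_C, NNReal.coe_toRealHom,
          Real.coe_toNNReal _ hc, sub_self]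
        exact dvd_zero _
    · rcases Nat.lt_or_ge (i : ℕ) m with him | him
      · -- `cᵢ < 0`, `i < m`: replace one factor `V₂` by its antipode `V₂'`
        obtain ⟨k, hk⟩ : ∃ k, m - (i : ℕ) = k + 1 := ⟨m - (i : ℕ) - 1, by omega⟩
        refine ⟨C (-c i).toNNReal * V₁ ^ (i : ℕ) * V₂' * V₂ ^ k, ?_, ?_⟩
        · refine (totalDegree_C_mul_pow_mul_mul_pow_le _ _ _ _ _ _ _ hd₁ hd₂' hd₂).trans
            (le_of_eq ?_)
          congr 1
          omega
        · rw [map_mul, map_mul, map_mul, map_pow, map_pow, map_C, NNReal.coe_toRealHom,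
            Real.coe_toNNReal _ (neg_pos.mpr hc).le, hk]
          refine (Dvd.dvd.mul_right h₂ (C (-c i) * MvPolynomial.map NNReal.toRealHom V₁ ^ (i : ℕ) *
            MvPolynomial.map NNReal.toRealHom V₂ ^ k)).trans (dvd_of_eq ?_)
          rw [map_neg, pow_succ]
          ring
      · -- `c_m < 0`: replace one factor `V₁` by its antipode `V₁'`
        have hieq : (i : ℕ) = m := le_antisymm hi him
        obtain ⟨k, hk⟩ : ∃ k, m = k + 1 := ⟨m - 1, by omega⟩
        refine ⟨C (-c i).toNNReal * V₁' ^ 1 * V₁ ^ k, ?_, ?_⟩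
        · refine (totalDegree_C_mul_pow_mul_pow_le _ _ _ _ _ _ hd₁' hd₁).trans (le_of_eq ?_)
          congr 1
          omega
        · rw [map_mul, map_mul, map_pow, map_pow, map_C, NNReal.coe_toRealHom,
            Real.coe_toNNReal _ (neg_pos.mpr hc).le, hieq, Nat.sub_self, hk]
          refine (Dvd.dvd.mul_right h₁ (C (-c i) * MvPolynomial.map NNReal.toRealHom V₁ ^ k)).trans
            (dvd_of_eq ?_)
          rw [map_neg, pow_succ]
          ring
  choose t ht using key
  refine ⟨∑ i, t i, totalDegree_finsetSum_le fun i _ => (ht i).1, ?_⟩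
  rw [map_sum, ← Finset.sum_sub_distrib]
  exact Finset.dvd_sum fun i _ => (ht i).2

end Summit.ValiantsHypothesis.ValiantsHypothesis.Theorems.DivisionGap.PerCofactorDegreeReduction.TwoSignedRealization

end
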